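import Mathlib
import HarnessLib

/-!
# Linear differential equations with holomorphic coefficients on a star-shaped domain:
# global holomorphic solutions through a prescribed value at the star centre, and uniqueness

Topic `Analysis/ODE`. The classical theorem (Coddington–Levinson, *Theory of Ordinary Differential Equations* (1955),
Ch. 3 §7 "Linear systems in the complex domain"; Hille, *Lectures on Ordinary Differential Equations* (1969), Ch. 2–3):
a linear system `F′(z) = A(z) F(z) + b(z)` with `A` (operator-valued) and `b` holomorphic on a simply connected domain
`U ⊂ ℂ` has, for every `z₀ ∈ U` and `v₀`, a unique holomorphic solution on ALL of `U` with `F(z₀) = v₀` — no shrinking of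
the domain, in contrast with the nonlinear Cauchy theorem. We prove it for STAR-SHAPED open `U` (star-convex with respect
to `z₀`), which is what transport along rays needs, by Picard iteration along the rays from `z₀` (the textbook proof):
* `hasDerivAt_rayPrimitive` — for `H` holomorphic on `U`, the ray primitive `z ↦ (z − z₀) • ∫₀¹ H(z₀ + t(z − z₀)) dt` has
  complex derivative `H` on `U` (differentiation under the integral sign + the fundamental theorem of calculus on the ray);
* `norm_rayPrimitive_le` — the Picard estimate `‖H‖ ≤ C tⁿ` along the ray ⟹ `‖ray primitive‖ ≤ ‖z − z₀‖ C/(n+1)`;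
* `exists_holomorphic_linearODE_of_starConvex` — EXISTENCE: `F = v₀ + Σₙ Dₙ`, `D₀` the ray primitive of `A v₀ + b`,
  `Dₙ₊₁` that of `A Dₙ`, `‖Dₙ(z)‖ ≤ C Mⁿ ‖z − z₀‖ⁿ⁺¹/(n+1)!` on cones over small balls, so the series converges locally
  uniformly, is holomorphic (`Complex.differentiableOn_tsum_of_summable_norm`) and may be differentiated termwise;
* `linearODE_unique_of_starConvex` — UNIQUENESS among functions satisfying the equation on `U` with the same value at `z₀`
  (Grönwall along each ray, `ODE_solution_unique_of_mem_Icc_right`); `existsUnique_…` packages both;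
* `hasDerivAt_linearODE_comp_path` — restriction to a real `C¹` path `γ` in `U`: `(F ∘ γ)′ = γ′ • (A (γ s) (F (γ s)) + b (γ s))`
  (chain rule), the form in which real-variable estimates along contours consume the solution.
Everything is proved; no definitions, no named facts; `E` is any complex Banach space (`A : ℂ → E →L[ℂ] E`).
References: E. A. Coddington, N. Levinson, *Theory of Ordinary Differential Equations*, McGraw–Hill (1955), Ch. 1 §3
(Picard iterates), Ch. 3 §7, Thm. 7.1 [CoddingtonLevinson1955]; E. Hille, *Lectures on Ordinary Differential Equations*,
Addison–Wesley (1969), Ch. 2–3 [Hille1969].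
-/

noncomputable section

open Set Metric Filter MeasureTheory intervalIntegral
open scoped Topology Nat NNReal

namespace Literature.Analysis.ODE

variable {E : Type*} [NormedAddCommGroup E] [NormedSpace ℂ E] [CompleteSpace E]

/-! ## Rays of a star-shaped set -/

/-- Points of the ray `z₀ + t (z − z₀)`, `0 ≤ t ≤ 1`, of a set star-convex with respect to `z₀` lie in the set. [folklore] -/
theorem ray_mem_of_starConvex {U : Set ℂ} {z₀ z : ℂ} (hst : StarConvex ℝ z₀ U) (hz : z ∈ U) {t : ℝ}
    (ht : t ∈ Icc (0 : ℝ) 1) : z₀ + (t : ℂ) * (z - z₀) ∈ U := by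
  have h := hst.add_smul_sub_mem hz ht.1 ht.2
  rwa [Complex.real_smul] at h

/-- The ray of a ray is a ray: `z₀ + s ((z₀ + t (z − z₀)) − z₀) = z₀ + (s t)(z − z₀)`. [folklore] -/
theorem complexRay_comp (z₀ z : ℂ) (s t : ℝ) :
    z₀ + (s : ℂ) * (z₀ + (t : ℂ) * (z - z₀) - z₀) = z₀ + ((s * t : ℝ) : ℂ) * (z - z₀) := by
  push_cast; ring

/-- The real path `t ↦ z₀ + t (z − z₀)` has derivative `z − z₀`. [folklore] -/
theorem hasDerivAt_complexRay (z₀ z : ℂ) (t : ℝ) :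
    HasDerivAt (fun s : ℝ => z₀ + (s : ℂ) * (z - z₀)) (z - z₀) t := by
  have h : HasDerivAt (fun s : ℝ => (s : ℂ)) 1 t := Complex.ofRealCLM.hasDerivAt
  simpa using (h.mul_const (z - z₀)).const_add z₀

/-- In the endpoint: `w ↦ z₀ + t (w − z₀)` has complex derivative `t`. [folklore] -/
theorem hasDerivAt_complexRay_endpoint (z₀ : ℂ) (t : ℝ) (w : ℂ) :
    HasDerivAt (fun w : ℂ => z₀ + (t : ℂ) * (w - z₀)) (t : ℂ) w := by
  simpa using (((hasDerivAt_id w).sub_const z₀).const_mul (t : ℂ)).const_add z₀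

/-- A compact neighbourhood of the ray inside the open set: for `z ∈ U` there are `δ > 0` and a compact `K ⊆ U` such that
every ray point `z₀ + t (w − z₀)`, `t ∈ [0, 1]`, `‖w − z‖ ≤ δ`, lies in `K`. [folklore] -/
theorem exists_compact_ray_nhds {U : Set ℂ} {z₀ z : ℂ} (hU : IsOpen U) (hst : StarConvex ℝ z₀ U) (hz : z ∈ U) :
    ∃ δ : ℝ, 0 < δ ∧ ∃ K : Set ℂ, IsCompact K ∧ K ⊆ U ∧
      ∀ w : ℂ, dist w z ≤ δ → ∀ t ∈ Icc (0 : ℝ) 1, z₀ + (t : ℂ) * (w - z₀) ∈ K := by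
  set K₀ : Set ℂ := (fun t : ℝ => z₀ + (t : ℂ) * (z - z₀)) '' Icc (0 : ℝ) 1 with hK₀
  have hK₀c : IsCompact K₀ := isCompact_Icc.image (by fun_prop)
  have hK₀U : K₀ ⊆ U := by
    rintro _ ⟨t, ht, rfl⟩
    exact ray_mem_of_starConvex hst hz ht
  obtain ⟨δ, hδ, hδU⟩ := hK₀c.exists_cthickening_subset_open hU hK₀U
  refine ⟨δ, hδ, cthickening δ K₀, hK₀c.cthickening, hδU, fun w hw t ht => ?_⟩
  refine Metric.mem_cthickening_of_dist_le _ (z₀ + (t : ℂ) * (z - z₀)) _ _ ⟨t, ht, rfl⟩ ?_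
  rw [dist_eq_norm] at hw ⊢
  have : z₀ + (t : ℂ) * (w - z₀) - (z₀ + (t : ℂ) * (z - z₀)) = (t : ℂ) * (w - z) := by ring
  rw [this, norm_mul, Complex.norm_real, Real.norm_eq_abs, abs_of_nonneg ht.1]
  calc t * ‖w - z‖ ≤ 1 * ‖w - z‖ := mul_le_mul_of_nonneg_right ht.2 (norm_nonneg _)
    _ ≤ δ := by rw [one_mul]; exact hw

/-! ## The ray primitive -/

/-- **The ray primitive of a holomorphic function on a star-shaped open set is a primitive.** For `H` holomorphic on the
open set `U`, star-convex with respect to `z₀`, the function `z ↦ (z − z₀) • ∫₀¹ H(z₀ + t (z − z₀)) dt` has complex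
derivative `H z` at every `z ∈ U`. (Differentiate under the integral sign — the integrand is holomorphic in `z` with
derivative `t • H′` bounded near the compact ray — and integrate `d/dt [t • H(z₀ + t (z − z₀))]` over `[0, 1]`.)
[cite: CoddingtonLevinson1955, Ch. 3 §7] -/
theorem hasDerivAt_rayPrimitive {U : Set ℂ} {z₀ z : ℂ} {H : ℂ → E} (hU : IsOpen U) (hst : StarConvex ℝ z₀ U)
    (hH : DifferentiableOn ℂ H U) (hz : z ∈ U) :
    HasDerivAt (fun w : ℂ => (w - z₀) • ∫ t in (0 : ℝ)..1, H (z₀ + (t : ℂ) * (w - z₀))) (H z) z := by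
  obtain ⟨δ, hδ, K, hKc, hKU, hK⟩ := exists_compact_ray_nhds hU hst hz
  -- `H′` is continuous on `U`, hence bounded on `K`
  have hHa : AnalyticOnNhd ℂ H U := hH.analyticOnNhd hU
  have hH'c : ContinuousOn (deriv H) U := (hHa.deriv).continuousOn
  have hHc : ContinuousOn H U := hH.continuousOn
  obtain ⟨M, hM⟩ := hKc.exists_bound_of_continuousOn (hH'c.mono hKU)
  -- continuity of the integrands along rays
  have hray_cont : ∀ w : ℂ, dist w z ≤ δ →
      ContinuousOn (fun t : ℝ => H (z₀ + (t : ℂ) * (w - z₀))) (Icc 0 1) := fun w hw =>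
    hHc.comp (by fun_prop) fun t ht => hKU (hK w hw t ht)
  have hray_cont' : ∀ w : ℂ, dist w z ≤ δ →
      ContinuousOn (fun t : ℝ => (t : ℂ) • deriv H (z₀ + (t : ℂ) * (w - z₀))) (Icc 0 1) := fun w hw =>
    (Complex.continuous_ofReal.continuousOn).smul (hH'c.comp (by fun_prop) fun t ht => hKU (hK w hw t ht))
  -- differentiation under the integral sign
  have hdiff := intervalIntegral.hasDerivAt_integral_of_dominated_loc_of_deriv_le
    (μ := volume) (a := (0 : ℝ)) (b := 1) (𝕜 := ℂ) (E := E)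
    (F := fun (w : ℂ) (t : ℝ) => H (z₀ + (t : ℂ) * (w - z₀)))
    (F' := fun (w : ℂ) (t : ℝ) => (t : ℂ) • deriv H (z₀ + (t : ℂ) * (w - z₀)))
    (x₀ := z) (s := closedBall z δ) (bound := fun _ => M) (closedBall_mem_nhds z hδ) ?_ ?_ ?_ ?_ ?_ ?_
  rotate_left
  · -- measurability near `z`
    filter_upwards [closedBall_mem_nhds z hδ] with w hw
    rw [uIoc_of_le zero_le_one]
    exact ((hray_cont w hw).mono Ioc_subset_Icc_self).aestronglyMeasurable measurableSet_Ioc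
  · exact ((hray_cont z (by simp [hδ.le])).mono (by rw [uIcc_of_le zero_le_one])).intervalIntegrable
  · rw [uIoc_of_le zero_le_one]
    exact ((hray_cont' z (by simp [hδ.le])).mono Ioc_subset_Icc_self).aestronglyMeasurable measurableSet_Ioc
  · refine Eventually.of_forall fun t ht w hw => ?_
    rw [uIoc_of_le zero_le_one] at ht
    rw [norm_smul, Complex.norm_real, Real.norm_eq_abs, abs_of_nonneg ht.1.le]
    calc t * ‖deriv H (z₀ + (t : ℂ) * (w - z₀))‖ ≤ 1 * M :=
          mul_le_mul ht.2 (hM _ (hK w hw t ⟨ht.1.le, ht.2⟩)) (norm_nonneg _) zero_le_one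
      _ = M := one_mul M
  · exact intervalIntegrable_const
  · refine Eventually.of_forall fun t ht w hw => ?_
    rw [uIoc_of_le zero_le_one] at ht
    have hwU : z₀ + (t : ℂ) * (w - z₀) ∈ U := hKU (hK w hw t ⟨ht.1.le, ht.2⟩)
    have h1 : HasDerivAt H (deriv H (z₀ + (t : ℂ) * (w - z₀))) (z₀ + (t : ℂ) * (w - z₀)) :=
      (hH.differentiableAt (hU.mem_nhds hwU)).hasDerivAt
    exact h1.scomp w (hasDerivAt_complexRay_endpoint z₀ t w)
  obtain ⟨-, hI⟩ := hdiff
  -- product rule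
  have hprod := ((hasDerivAt_id z).sub_const z₀).smul hI
  simp only [id] at hprod
  refine hprod.congr_deriv ?_
  -- the fundamental theorem of calculus along the ray at `z`
  have hzδ : dist z z ≤ δ := by simp [hδ.le]
  have hdFG : ∀ t : ℝ, t ∈ uIcc (0 : ℝ) 1 → HasDerivAt (fun s : ℝ => (s : ℂ) • H (z₀ + (s : ℂ) * (z - z₀)))
      ((t : ℂ) • ((z - z₀) • deriv H (z₀ + (t : ℂ) * (z - z₀))) + (1 : ℂ) • H (z₀ + (t : ℂ) * (z - z₀))) t := by
    intro t ht
    rw [uIcc_of_le zero_le_one] at ht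
    have h1 : HasDerivAt H (deriv H (z₀ + (t : ℂ) * (z - z₀))) (z₀ + (t : ℂ) * (z - z₀)) :=
      (hH.differentiableAt (hU.mem_nhds (hKU (hK z hzδ t ht)))).hasDerivAt
    exact (Complex.ofRealCLM.hasDerivAt (x := t)).smul (h1.scomp t (hasDerivAt_complexRay z₀ z t))
  have hi1 : IntervalIntegrable (fun t : ℝ => (t : ℂ) • ((z - z₀) • deriv H (z₀ + (t : ℂ) * (z - z₀)))) volume 0 1 := by
    refine ContinuousOn.intervalIntegrable ?_
    rw [uIcc_of_le zero_le_one]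
    refine (Complex.continuous_ofReal.continuousOn).smul ?_
    exact (hH'c.comp (by fun_prop) fun t ht => hKU (hK z hzδ t ht)).const_smul (z - z₀)
  have hi2 : IntervalIntegrable (fun t : ℝ => H (z₀ + (t : ℂ) * (z - z₀))) volume 0 1 :=
    ((hray_cont z hzδ).mono (by rw [uIcc_of_le zero_le_one])).intervalIntegrable
  have hftc := intervalIntegral.integral_eq_sub_of_hasDerivAt hdFG (hi1.add (hi2.smul (1 : ℂ)))
  simp only [Complex.ofReal_one, one_smul, Complex.ofReal_zero, zero_smul, sub_zero, one_mul, zero_mul,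
    add_zero] at hftc
  -- `∫ (t • (z − z₀) • H′ + H) = (z − z₀) • ∫ t • H′ + ∫ H`
  rw [intervalIntegral.integral_add hi1 hi2] at hftc
  have hcomm : (fun t : ℝ => (t : ℂ) • ((z - z₀) • deriv H (z₀ + (t : ℂ) * (z - z₀)))) =
      fun t : ℝ => (z - z₀) • ((t : ℂ) • deriv H (z₀ + (t : ℂ) * (z - z₀))) := funext fun t => smul_comm _ _ _
  rw [hcomm, intervalIntegral.integral_smul, add_sub_cancel] at hftc
  rw [one_smul]
  exact hftc

omit [CompleteSpace E] in
/-- **The Picard estimate along a ray.** If `‖H(z₀ + t (z − z₀))‖ ≤ C tⁿ` for `t ∈ [0, 1]` then the ray primitive satisfies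
`‖(z − z₀) • ∫₀¹ H(z₀ + t (z − z₀)) dt‖ ≤ ‖z − z₀‖ · C/(n + 1)`. [cite: CoddingtonLevinson1955, Ch. 1 §3] -/
theorem norm_rayPrimitive_le {z₀ z : ℂ} {H : ℂ → E} {C : ℝ} {n : ℕ}
    (h : ∀ t ∈ Icc (0 : ℝ) 1, ‖H (z₀ + (t : ℂ) * (z - z₀))‖ ≤ C * t ^ n) :
    ‖(z - z₀) • ∫ t in (0 : ℝ)..1, H (z₀ + (t : ℂ) * (z - z₀))‖ ≤ ‖z - z₀‖ * (C / (n + 1)) := by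
  rw [norm_smul]
  refine mul_le_mul_of_nonneg_left ?_ (norm_nonneg _)
  have hle : ‖∫ t in (0 : ℝ)..1, H (z₀ + (t : ℂ) * (z - z₀))‖ ≤ ∫ t in (0 : ℝ)..1, C * t ^ n :=
    intervalIntegral.norm_integral_le_of_norm_le zero_le_one
      (Eventually.of_forall fun t ht => h t ⟨ht.1.le, ht.2⟩) ((continuous_const.mul (continuous_pow n)).intervalIntegrable _ _)
  calc ‖∫ t in (0 : ℝ)..1, H (z₀ + (t : ℂ) * (z - z₀))‖ ≤ ∫ t in (0 : ℝ)..1, C * t ^ n := hle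
    _ = C / (n + 1) := by
      rw [intervalIntegral.integral_const_mul, integral_pow]
      simp [div_eq_mul_inv]

/-! ## Existence -/

/-- **Linear ODE with holomorphic coefficients on a star-shaped domain: global holomorphic solution.** Let `U ⊂ ℂ` be
open and star-convex with respect to `z₀`, `A : ℂ → (E →L[ℂ] E)` and `b : ℂ → E` holomorphic on `U` (`E` a complex Banach
space). Then for every `v₀` there is `F : ℂ → E`, holomorphic on `U`, with `F z₀ = v₀` and `F′(z) = A(z) F(z) + b(z)` at every
`z ∈ U`. Proof: Picard iteration along rays, `F = v₀ + Σ Dₙ` with `D₀ = ∫_{[z₀,z]}(A v₀ + b)`, `Dₙ₊₁ = ∫_{[z₀,z]} A Dₙ`,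
`‖Dₙ(z)‖ ≤ C Mⁿ‖z − z₀‖ⁿ⁺¹/(n+1)!` on the cone over a small ball (constants = suprema over a compact neighbourhood of the ray),
termwise differentiation of the locally uniformly convergent series. [cite: CoddingtonLevinson1955, Ch. 3 §7, Thm 7.1] -/
theorem exists_holomorphic_linearODE_of_starConvex {U : Set ℂ} {z₀ : ℂ} (hU : IsOpen U) (hst : StarConvex ℝ z₀ U)
    {A : ℂ → E →L[ℂ] E} (hA : DifferentiableOn ℂ A U) {b : ℂ → E} (hb : DifferentiableOn ℂ b U) (v₀ : E) :
    ∃ F : ℂ → E, DifferentiableOn ℂ F U ∧ F z₀ = v₀ ∧ ∀ z ∈ U, HasDerivAt F (A z (F z) + b z) z := by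
  -- the Picard terms
  set T : (ℂ → E) → ℂ → E := fun G w => (w - z₀) • ∫ t in (0 : ℝ)..1, A (z₀ + (t : ℂ) * (w - z₀)) (G (z₀ + (t : ℂ) * (w - z₀)))
    with hT
  set D0 : ℂ → E := fun w => (w - z₀) • ∫ t in (0 : ℝ)..1, (A (z₀ + (t : ℂ) * (w - z₀)) v₀ + b (z₀ + (t : ℂ) * (w - z₀)))
    with hD0
  set D : ℕ → ℂ → E := fun n => T^[n] D0 with hD
  have hDsucc : ∀ n, D (n + 1) = T (D n) := fun n => Function.iterate_succ_apply' T n D0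
  -- each term is holomorphic with the expected derivative
  have hD0' : ∀ z ∈ U, HasDerivAt (D 0) (A z v₀ + b z) z := fun z hz =>
    hasDerivAt_rayPrimitive (H := fun w => A w v₀ + b w) hU hst ((hA.clm_apply (differentiableOn_const v₀)).add hb) hz
  have hDsucc' : ∀ n, DifferentiableOn ℂ (D n) U → ∀ z ∈ U, HasDerivAt (D (n + 1)) (A z (D n z)) z :=
    fun n hn z hz => by rw [hDsucc]; exact hasDerivAt_rayPrimitive (H := fun w => A w (D n w)) hU hst (hA.clm_apply hn) hz
  have hDdiff : ∀ n, DifferentiableOn ℂ (D n) U := fun n => by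
    induction n with
    | zero => exact fun z hz => (hD0' z hz).differentiableAt.differentiableWithinAt
    | succ n ih => exact fun z hz => (hDsucc' n ih z hz).differentiableAt.differentiableWithinAt
  -- the terms vanish at the centre
  have hDz₀ : ∀ n, D n z₀ = 0 := fun n => by
    cases n with
    | zero => simp [hD, hD0]
    | succ n => rw [hDsucc]; simp [hT]
  -- local uniform bounds: on a ball around each `z ∈ U` the terms are dominated by an exponential series
  have hloc : ∀ z ∈ U, ∃ δ : ℝ, 0 < δ ∧ closedBall z δ ⊆ U ∧ ∃ u : ℕ → ℝ, Summable u ∧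
      ∀ n, ∀ w ∈ ball z δ, ‖D n w‖ ≤ u n := by
    intro z hz
    obtain ⟨δ, hδ, K, hKc, hKU, hK⟩ := exists_compact_ray_nhds hU hst hz
    have hAc : ContinuousOn A K := hA.continuousOn.mono hKU
    have hHc : ContinuousOn (fun w => A w v₀ + b w) K := ((hA.clm_apply (differentiableOn_const v₀)).add hb).continuousOn.mono hKU
    obtain ⟨M, hM⟩ := hKc.exists_bound_of_continuousOn hAc
    obtain ⟨C, hC⟩ := hKc.exists_bound_of_continuousOn hHc
    have hM0 : 0 ≤ M := le_trans (norm_nonneg _) (hM _ (hK z (by simp [hδ.le]) 1 ⟨zero_le_one, le_rfl⟩))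
    have hC0 : 0 ≤ C := le_trans (norm_nonneg _) (hC _ (hK z (by simp [hδ.le]) 1 ⟨zero_le_one, le_rfl⟩))
    -- the cone `S` over the closed ball: star-shaped, inside `K`
    set S : Set ℂ := {w | ∀ t ∈ Icc (0 : ℝ) 1, z₀ + (t : ℂ) * (w - z₀) ∈ K} with hS
    have hSK : S ⊆ K := fun w hw => by simpa using hw 1 ⟨zero_le_one, le_rfl⟩
    have hSray : ∀ w ∈ S, ∀ t ∈ Icc (0 : ℝ) 1, z₀ + (t : ℂ) * (w - z₀) ∈ S := by
      intro w hw t ht s hs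
      rw [complexRay_comp]
      exact hw (s * t) ⟨mul_nonneg hs.1 ht.1, mul_le_one₀ hs.2 ht.1 ht.2⟩
    have hballS : closedBall z δ ⊆ S := fun w hw t ht => hK w (mem_closedBall.1 hw) t ht
    -- the Picard estimate on the cone
    have hest : ∀ n, ∀ w ∈ S, ‖D n w‖ ≤ C * M ^ n * ‖w - z₀‖ ^ (n + 1) / (n + 1)! := fun n => by
      induction n with
      | zero =>
        intro w hw
        have h := norm_rayPrimitive_le (z₀ := z₀) (z := w) (H := fun w => A w v₀ + b w) (C := C) (n := 0)
          (fun t ht => by simpa using hC _ (hw t ht))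
        have h' : ‖D 0 w‖ ≤ ‖w - z₀‖ * C := by simpa [hD, hD0] using h
        calc ‖D 0 w‖ ≤ ‖w - z₀‖ * C := h'
          _ = C * M ^ 0 * ‖w - z₀‖ ^ (0 + 1) / (0 + 1)! := by simp [mul_comm]
      | succ n ih =>
        intro w hw
        rw [hDsucc]
        have key : ∀ t ∈ Icc (0 : ℝ) 1, ‖A (z₀ + (t : ℂ) * (w - z₀)) (D n (z₀ + (t : ℂ) * (w - z₀)))‖ ≤
            (C * M ^ (n + 1) * ‖w - z₀‖ ^ (n + 1) / (n + 1)!) * t ^ (n + 1) := by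
          intro t ht
          have h1 := ih _ (hSray w hw t ht)
          have hnorm : ‖z₀ + (t : ℂ) * (w - z₀) - z₀‖ = t * ‖w - z₀‖ := by
            rw [add_sub_cancel_left, norm_mul, Complex.norm_real, Real.norm_eq_abs, abs_of_nonneg ht.1]
          rw [hnorm] at h1
          calc ‖A (z₀ + (t : ℂ) * (w - z₀)) (D n (z₀ + (t : ℂ) * (w - z₀)))‖
              ≤ ‖A (z₀ + (t : ℂ) * (w - z₀))‖ * ‖D n (z₀ + (t : ℂ) * (w - z₀))‖ := ContinuousLinearMap.le_opNorm _ _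
            _ ≤ M * (C * M ^ n * (t * ‖w - z₀‖) ^ (n + 1) / (n + 1)!) := mul_le_mul (hM _ (hw t ht)) h1 (norm_nonneg _) hM0
            _ = (C * M ^ (n + 1) * ‖w - z₀‖ ^ (n + 1) / (n + 1)!) * t ^ (n + 1) := by ring
        have h := norm_rayPrimitive_le (z₀ := z₀) (z := w) (H := fun w' => A w' (D n w'))
          (C := C * M ^ (n + 1) * ‖w - z₀‖ ^ (n + 1) / (n + 1)!) (n := n + 1) key
        calc ‖T (D n) w‖ ≤ ‖w - z₀‖ * (C * M ^ (n + 1) * ‖w - z₀‖ ^ (n + 1) / (n + 1)! / ((n + 1 : ℕ) + 1)) := h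
          _ = C * M ^ (n + 1) * ‖w - z₀‖ ^ (n + 1 + 1) / (n + 1 + 1)! := by
            rw [Nat.factorial_succ (n + 1)]
            push_cast
            have h1 : (((n + 1)! : ℕ) : ℝ) ≠ 0 := by positivity
            field_simp
            ring
    -- on the ball: an exponential series
    set R : ℝ := ‖z - z₀‖ + δ with hR
    have hR0 : 0 ≤ R := by positivity
    refine ⟨δ, hδ, fun w hw => hKU (hSK (hballS hw)), fun n => C * R * (M * R) ^ n / n !, ?_, ?_⟩
    · have := (Real.summable_pow_div_factorial (M * R)).mul_left (C * R)
      refine this.congr fun n => ?_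
      ring
    · intro n w hw
      have hwS : w ∈ S := hballS (ball_subset_closedBall hw)
      have hwR : ‖w - z₀‖ ≤ R := by
        have : w - z₀ = (w - z) + (z - z₀) := by ring
        rw [this, hR]
        calc ‖(w - z) + (z - z₀)‖ ≤ ‖w - z‖ + ‖z - z₀‖ := norm_add_le _ _
          _ ≤ δ + ‖z - z₀‖ := by
              have : ‖w - z‖ < δ := by rwa [← dist_eq_norm, ← mem_ball]
              linarith
          _ = ‖z - z₀‖ + δ := add_comm _ _
      calc ‖D n w‖ ≤ C * M ^ n * ‖w - z₀‖ ^ (n + 1) / (n + 1)! := hest n w hwS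
        _ ≤ C * M ^ n * R ^ (n + 1) / (n + 1)! := by
            gcongr
        _ ≤ C * M ^ n * R ^ (n + 1) / n ! := by
            refine div_le_div_of_nonneg_left (by positivity) (by positivity) ?_
            exact_mod_cast Nat.factorial_le (Nat.le_succ n)
        _ = C * R * (M * R) ^ n / n ! := by ring
  -- the sum
  refine ⟨fun w => v₀ + ∑' n, D n w, ?_, ?_, ?_⟩
  · intro z hz
    obtain ⟨δ, hδ, hδU, u, hu, hbound⟩ := hloc z hz
    have hdiff : DifferentiableOn ℂ (fun w => ∑' n, D n w) (ball z δ) :=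
      Complex.differentiableOn_tsum_of_summable_norm hu (fun n => (hDdiff n).mono ((ball_subset_closedBall).trans hδU))
        isOpen_ball hbound
    exact ((differentiableAt_const v₀).add (hdiff.differentiableAt (isOpen_ball.mem_nhds (mem_ball_self hδ)))).differentiableWithinAt
  · simp [hDz₀]
  · intro z hz
    obtain ⟨δ, hδ, hδU, u, hu, hbound⟩ := hloc z hz
    have hsub : ball z δ ⊆ U := (ball_subset_closedBall).trans hδU
    have hdiff : DifferentiableOn ℂ (fun w => ∑' n, D n w) (ball z δ) :=
      Complex.differentiableOn_tsum_of_summable_norm hu (fun n => (hDdiff n).mono hsub) isOpen_ball hbound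
    have hderiv : HasSum (fun n => deriv (D n) z) (deriv (fun w => ∑' n, D n w) z) :=
      Complex.hasSum_deriv_of_summable_norm hu (fun n => (hDdiff n).mono hsub) isOpen_ball hbound (mem_ball_self hδ)
    -- the termwise derivatives: `A z v₀ + b z`, then `A z (D n z)`
    have hsumD : HasSum (fun n => D n z) (∑' n, D n z) := (Summable.of_norm_bounded hu fun n => hbound n z (mem_ball_self hδ)).hasSum
    have hshift : HasSum (fun n => deriv (D (n + 1)) z) (A z (∑' n, D n z)) :=
      (hsumD.mapL (A z)).congr_fun fun n => (hDsucc' n (hDdiff n) z hz).deriv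
    have hfull : HasSum (fun n => deriv (D n) z) (A z (∑' n, D n z) + (A z v₀ + b z)) := by
      have h := (hasSum_nat_add_iff (f := fun n => deriv (D n) z) 1).1 hshift
      simpa [(hD0' z hz).deriv] using h
    have heq : deriv (fun w => ∑' n, D n w) z = A z (∑' n, D n z) + (A z v₀ + b z) := hderiv.unique hfull
    have hat : HasDerivAt (fun w => ∑' n, D n w) (deriv (fun w => ∑' n, D n w) z) z :=
      (hdiff.differentiableAt (isOpen_ball.mem_nhds (mem_ball_self hδ))).hasDerivAt
    rw [heq] at hat
    refine ((hasDerivAt_const z v₀).add hat).congr_deriv ?_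
    simp only [map_add, zero_add]
    abel

/-! ## Uniqueness -/

omit [CompleteSpace E] in
/-- **Uniqueness on a star-shaped domain.** Two functions satisfying `F′ = A F + b` at every point of the open set `U`,
star-convex with respect to `z₀`, with `A` continuous on `U`, and agreeing at `z₀`, agree on `U` (Grönwall along each
ray `[z₀, z] ⊆ U`: the difference solves the real-parameter linear equation `d′(t) = (z − z₀) • A(z₀ + t(z − z₀)) d(t)` with
`d(0) = 0`). No holomorphy is needed. [cite: CoddingtonLevinson1955, Ch. 3 §7] -/
theorem linearODE_unique_of_starConvex {U : Set ℂ} {z₀ : ℂ} (hU : IsOpen U) (hst : StarConvex ℝ z₀ U)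
    {A : ℂ → E →L[ℂ] E} (hA : ContinuousOn A U) {b : ℂ → E} {F G : ℂ → E}
    (hF : ∀ z ∈ U, HasDerivAt F (A z (F z) + b z) z) (hG : ∀ z ∈ U, HasDerivAt G (A z (G z) + b z) z)
    (h0 : F z₀ = G z₀) : EqOn F G U := by
  intro z hz
  obtain ⟨δ, hδ, K, hKc, hKU, hK⟩ := exists_compact_ray_nhds hU hst hz
  obtain ⟨M, hM⟩ := hKc.exists_bound_of_continuousOn (hA.mono hKU)
  have hzδ : dist z z ≤ δ := by simp [hδ.le]
  have hM0 : 0 ≤ M := le_trans (norm_nonneg _) (hM _ (hK z hzδ 0 ⟨le_rfl, zero_le_one⟩))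
  -- the difference along the ray
  set dFG : ℝ → E := fun t => F (z₀ + (t : ℂ) * (z - z₀)) - G (z₀ + (t : ℂ) * (z - z₀)) with hdFG
  set v : ℝ → E → E := fun t x => (z - z₀) • A (z₀ + (t : ℂ) * (z - z₀)) x with hv
  have hdFG' : ∀ t ∈ Icc (0 : ℝ) 1, HasDerivAt dFG (v t (dFG t)) t := by
    intro t ht
    have htU : z₀ + (t : ℂ) * (z - z₀) ∈ U := hKU (hK z hzδ t ht)
    have h1 := (hF _ htU).scomp t (hasDerivAt_complexRay z₀ z t)
    have h2 := (hG _ htU).scomp t (hasDerivAt_complexRay z₀ z t)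
    refine (h1.sub h2).congr_deriv ?_
    simp only [hv, hdFG, map_sub, smul_sub, smul_add]
    abel
  set Kl : ℝ≥0 := ⟨‖z - z₀‖ * M, by positivity⟩ with hKl
  have hlip : ∀ t ∈ Ico (0 : ℝ) 1, LipschitzOnWith Kl (v t) univ := by
    intro t ht
    have hop : ‖(z - z₀) • A (z₀ + (t : ℂ) * (z - z₀))‖₊ ≤ Kl := by
      rw [← NNReal.coe_le_coe, coe_nnnorm, norm_smul]
      exact mul_le_mul_of_nonneg_left (hM _ (hK z hzδ t ⟨ht.1, ht.2.le⟩)) (norm_nonneg _)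
    have hfun : v t = ⇑((z - z₀) • A (z₀ + (t : ℂ) * (z - z₀))) := by
      funext x; simp [hv]
    rw [hfun]
    exact (((z - z₀) • A (z₀ + (t : ℂ) * (z - z₀))).lipschitz.weaken hop).lipschitzOnWith
  have hcont : ContinuousOn dFG (Icc 0 1) := fun t ht => (hdFG' t ht).continuousAt.continuousWithinAt
  have hzero : ∀ t ∈ Ico (0 : ℝ) 1, HasDerivWithinAt (fun _ : ℝ => (0 : E)) (v t ((fun _ : ℝ => (0 : E)) t)) (Ici t) t := by
    intro t _
    simpa [hv] using (hasDerivWithinAt_const t (Ici t) (0 : E))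
  have huniq := ODE_solution_unique_of_mem_Icc_right (v := v) (s := fun _ => univ) (K := Kl) (f := dFG)
    (g := fun _ => (0 : E)) (a := 0) (b := 1) hlip hcont
    (fun t ht => (hdFG' t ⟨ht.1, ht.2.le⟩).hasDerivWithinAt) (fun _ _ => mem_univ _) continuousOn_const hzero
    (fun _ _ => mem_univ _) (by simp [hdFG, h0])
  simpa [hdFG, sub_eq_zero] using huniq ⟨zero_le_one, le_rfl⟩

/-! ## Restriction to real paths -/

omit [CompleteSpace E] in
/-- **Restriction of a complex-domain ODE to a `C¹` path.** If `F′(w) = A(w) F(w) + b(w)` (complex derivative) at the point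
`w = γ s` of a real path `γ` with `γ′(s) = γ′`, then `s ↦ F (γ s)` has real derivative `γ′ • (A (γ s) (F (γ s)) + b (γ s))`
at `s` (chain rule) — the real-parameter linear equation along the path, to which Grönwall / variation-of-constants
estimates apply. [folklore] -/
theorem hasDerivAt_linearODE_comp_path {A : ℂ → E →L[ℂ] E} {b : ℂ → E} {F : ℂ → E} {γ : ℝ → ℂ} {γ' : ℂ} {s : ℝ}
    (hF : HasDerivAt F (A (γ s) (F (γ s)) + b (γ s)) (γ s)) (hγ : HasDerivAt γ γ' s) :
    HasDerivAt (fun σ : ℝ => F (γ σ)) (γ' • (A (γ s) (F (γ s)) + b (γ s))) s :=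
  hF.scomp s hγ

omit [CompleteSpace E] in
/-- The same for a function satisfying the equation on a set `U`, at a path point in `U`. [folklore] -/
theorem hasDerivAt_linearODE_comp_path_of_mem {U : Set ℂ} {A : ℂ → E →L[ℂ] E} {b : ℂ → E} {F : ℂ → E}
    (hF : ∀ z ∈ U, HasDerivAt F (A z (F z) + b z) z) {γ : ℝ → ℂ} {γ' : ℂ} {s : ℝ} (hγ : HasDerivAt γ γ' s)
    (hs : γ s ∈ U) : HasDerivAt (fun σ : ℝ => F (γ σ)) (γ' • (A (γ s) (F (γ s)) + b (γ s))) s :=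
  (hF _ hs).scomp s hγ

/-- **Existence and uniqueness packaged.** On an open set star-convex with respect to `z₀`, with holomorphic `A`, `b`:
there is exactly one function satisfying the equation on `U` with value `v₀` at `z₀`, and it is holomorphic.
[cite: CoddingtonLevinson1955, Ch. 3 §7, Thm 7.1] -/
theorem existsUnique_holomorphic_linearODE_of_starConvex {U : Set ℂ} {z₀ : ℂ} (hU : IsOpen U)
    (hst : StarConvex ℝ z₀ U) (hz₀ : z₀ ∈ U) {A : ℂ → E →L[ℂ] E} (hA : DifferentiableOn ℂ A U) {b : ℂ → E}
    (hb : DifferentiableOn ℂ b U) (v₀ : E) :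
    ∃ F : ℂ → E, (DifferentiableOn ℂ F U ∧ F z₀ = v₀ ∧ ∀ z ∈ U, HasDerivAt F (A z (F z) + b z) z) ∧
      ∀ G : ℂ → E, G z₀ = v₀ → (∀ z ∈ U, HasDerivAt G (A z (G z) + b z) z) → EqOn G F U := by
  obtain ⟨F, hFd, hF0, hF'⟩ := exists_holomorphic_linearODE_of_starConvex hU hst hA hb v₀
  refine ⟨F, ⟨hFd, hF0, hF'⟩, fun G hG0 hG' => ?_⟩
  have _ := hz₀
  exact linearODE_unique_of_starConvex hU hst hA.continuousOn hG' hF' (hG0.trans hF0.symm)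

end Literature.Analysis.ODE

end
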